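import Mathlib
import Summits.NavierStokesRegularity.NavierStokesRegularity.Theorems.TaoLadderRungTwoFlatGappedFrontRobustTailEnergyOn
import Summits.NavierStokesRegularity.NavierStokesRegularity.Theorems.TaoLadderRungTwoFlatGappedFrontRobustQuadTermOn
import Summits.NavierStokesRegularity.NavierStokesRegularity.Theorems.TaoLadderRungTwoFlatGappedFrontRobustMotionIntegralOn
import Summits.NavierStokesRegularity.NavierStokesRegularity.Theorems.TaoLadderRungThreeGappedFrontRobustComparison
import Summits.NavierStokesRegularity.NavierStokesRegularity.Theorems.TaoLadderRungTwoFlatGappedFrontRobustFluxOn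
import HarnessLib

/-!
# Shift-set pseudo-flows `PseudoFlowOnShift 𝕊`: THE FRONT BLOCK AND THE SHELLS BEHIND IT, JOINTLY
  (a priori control of ONE flow on all shells below the tail without the certificate's epoch envelope;
  helper for item stmt-NavierStokesRegularity-22988 `GappedFrontRobustV2Flat`, crux K_B♭ of route
  TaoLadderRungTwoFlat)

The `𝕊`-parametrised version of `Theorems/TaoLadderRungThreeGappedFrontRobustBlockBehind.lean` (p1 g9, one-way
`S`): `GappedFrontRobust.bootstrap_family` over the index type `Option (Fin m × ℤ)` with the constant
profile, combining the block energy inequality on `𝕊` (tree: `PseudoFlowOnShift.block_energy_le`) for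
the finite FRONT BLOCK `kb+1 … kb+Lb` with the small-rate drift bound for the shells `≤ kb` BEHIND it.
What changes on a two-way shift set: each of the two boundary fluxes of the block has, besides the
one-way term (two factors below the bond), a backscatter term with two factors ABOVE the bond —
`|B_𝕊(n)| ≤ (1+ε₀)^{5n/2} (∑_{bot}|α|) (P² Q + P Q²)` for `|X_n| ≤ P`, `|X_{n+1}| ≤ Q`
(`abs_botSumOn_le_two_slot`, `…FluxOn`); so the scalar block condition `hcondBlock` carries the extra terms
`Ĝ(kb)·(2√E₁)²` (bottom) and `√(4E₁)·Atop²` (top), both small by the same mechanisms (slow clock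
behind, small tail amplitude ahead). Here: the two
improvement steps `pseudoFlowOnShift_block_improve` / `pseudoFlowOnShift_behind_improve`, and the joint
theorem `pseudoFlowOnShift_block_and_behind` (same conclusion as on `S`: drift `≤ G n` behind, block
energy `≤ E₁`).

HONEST FRAMING: a theorem about Tao-type MODEL lattice pseudo-flows (Tao 2016 §4 Lemma 4.1 (4.5),
(4.8)–(4.9) with (4.3)) on a general nearest-neighbour shift set; nothing here concerns the
Navier–Stokes equations; nothing is asserted about any table (p1 g12).
-/

noncomputable section

-- the sub-problem namespace `Summit.NavierStokesRegularity.NavierStokesRegularity` repeats the summit name by design (D-0017)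
set_option linter.dupNamespace false

namespace Summit.NavierStokesRegularity.NavierStokesRegularity.Theorems

open Set MeasureTheory intervalIntegral Literature.Analysis.FluidPDE Literature.Analysis.FluidPDE.TaoCascade

namespace GappedFrontRobustOn

variable {m : ℕ} {𝕊 : Finset (ℤ × ℤ × ℤ)}

variable {τ ε₀ : ℝ} {α : Fin m → Fin m → Fin m → ℤ × ℤ × ℤ → ℝ} {κ₁ κ₂ : ℝ}
  {S₀ F₀ B₀ : Fin m → ℤ → ℝ} {S F : Fin m → ℤ → ℝ → ℝ}

/-! ### The two improvement steps -/

/-- **Block improvement step on `𝕊`** (one clock window, given bounds on `[0, t]`): the energy of the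
front block `kb+1 … kb+Lb` at time `t` is at most its start value plus the two boundary fluxes
integrated over `[0, t]` (`PseudoFlowOnShift.block_energy_le`); these are small when the behind shell
`kb` is tame (`|S_{·,kb}| ≤ Pb`), the first block shell is bounded (`≤ Q1`), the top block shell is
energy-bounded (`≤ Etop`) and the first tail shell is small (`≤ Atop`); each flux has a one-way and a
backscatter part (`abs_botSumOn_le_two_slot`). [cite: Tao2016AveragedNS, §4 Lemma 4.1 (4.9) with (4.3)] -/
theorem pseudoFlowOnShift_block_improve (h𝕊 : IsNearestNeighbourSet 𝕊) (h𝕊c : IsSlotClosed 𝕊)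
    (h111 : ((1 : ℤ), (1 : ℤ), (1 : ℤ)) ∉ 𝕊) (h : PseudoFlowOnShift 𝕊 τ ε₀ α κ₁ κ₂ S₀ F₀ B₀ S F)
    (hτ : 0 < τ) (hε : 0 < ε₀) (hα : IsCancellingCoeffOn 𝕊 α) (kb : ℤ) (Lb : ℕ)
    {Pb Q1 Atop Etop E₁ : ℝ} (hPb0 : 0 ≤ Pb) (hQ10 : 0 ≤ Q1) (hAtop0 : 0 ≤ Atop) (hEtop0 : 0 ≤ Etop)
    {t : ℝ} (ht : t ∈ Icc 0 τ)
    (hblock0 : ∑ k ∈ Finset.range Lb, ∑ i, F₀ i (kb + 1 + k) ≤ E₁ / 2)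
    (hPb : ∀ s ∈ Icc 0 t, ∀ i : Fin m, |S i kb s| ≤ Pb)
    (hQ1 : ∀ s ∈ Icc 0 t, ∀ i : Fin m, |S i (kb + 1) s| ≤ Q1)
    (hAtop : ∀ s ∈ Icc 0 t, ∀ i : Fin m, |S i (kb + Lb + 1) s| ≤ Atop)
    (hEtop : ∀ s ∈ Icc 0 t, ∑ i, F i (kb + Lb) s ≤ Etop)
    (hcond : τ * ((1 + ε₀) ^ ((5 : ℝ) * kb / 2) * coeffAbsOn (botShifts 𝕊) α *
        (Pb ^ 2 * Q1 + Pb * Q1 ^ 2) +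
      (1 + ε₀) ^ ((5 : ℝ) * ((kb + Lb : ℤ) : ℝ) / 2) * coeffAbsOn (botShifts 𝕊) α *
        (2 * Etop * Atop + Real.sqrt (2 * Etop) * Atop ^ 2)) ≤ E₁ / 2) :
    ∑ k ∈ Finset.range Lb, ∑ i, F i (kb + 1 + k) t ≤ E₁ := by
  have hq : 0 < 1 + ε₀ := by linarith
  set C : ℝ := coeffAbsOn (botShifts 𝕊) α with hC
  have hC0 : 0 ≤ C := coeffAbsOn_nonneg _ _
  have htτ : Icc 0 t ⊆ Icc 0 τ := fun s hs => ⟨hs.1, hs.2.trans ht.2⟩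
  have hsub : uIcc 0 t ⊆ Icc 0 τ := by rw [uIcc_of_le ht.1]; exact Icc_subset_Icc_right ht.2
  have hS : ∀ i n, ContinuousOn (S i n) (Icc 0 τ) := fun i n => (h.contDiffOn_S i n).continuousOn
  have hbint : ∀ n : ℤ, IntervalIntegrable (fun s => botSumOn 𝕊 ε₀ α S n s) volume 0 t := fun n =>
    ((continuousOn_botSumOn 𝕊 ε₀ α hS n).mono hsub).intervalIntegrable
  have hout' : ∀ μ ∈ 𝕊, μ.2.2 = 0 ∨ μ.2.2 = 1 := fun μ hμ => (h𝕊 μ hμ).2.2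
  have hblk := h.block_energy_le hτ h𝕊c hout' hα (kb + 1) Lb ht
  have hkt : kb + 1 + ((Lb : ℕ) : ℤ) - 1 = kb + Lb := by ring
  rw [show kb + 1 - 1 = kb by ring, hkt, intervalIntegral.integral_sub (hbint _) (hbint _)] at hblk
  -- pointwise flux bounds on [0, t]
  have hin : ∀ s ∈ Icc 0 t, |botSumOn 𝕊 ε₀ α S kb s| ≤
      (1 + ε₀) ^ ((5 : ℝ) * kb / 2) * C * (Pb ^ 2 * Q1 + Pb * Q1 ^ 2) :=
    fun s hs => abs_botSumOn_le_two_slot h𝕊 h111 ε₀ hq α S kb s hPb0 hQ10 (hPb s hs) (hQ1 s hs)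
  have hout : ∀ s ∈ Icc 0 t, |botSumOn 𝕊 ε₀ α S (kb + Lb) s| ≤
      (1 + ε₀) ^ ((5 : ℝ) * ((kb + Lb : ℤ) : ℝ) / 2) * C *
        (2 * Etop * Atop + Real.sqrt (2 * Etop) * Atop ^ 2) := by
    intro s hs
    have hsτ := htτ hs
    -- amplitudes of the top block shell through its energy
    have hy0 : 0 ≤ ∑ i, F i (kb + Lb) s := Finset.sum_nonneg fun i _ => h.nonneg_F i _ s hsτ
    have hP : ∀ i, |S i (kb + Lb) s| ≤ Real.sqrt (2 * ∑ j, F j (kb + Lb) s) := by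
      intro i
      have h1 : F i (kb + Lb) s ≤ ∑ j, F j (kb + Lb) s :=
        Finset.single_le_sum (f := fun j => F j (kb + Lb) s) (fun j _ => h.nonneg_F j _ s hsτ)
          (Finset.mem_univ i)
      exact Real.abs_le_sqrt (by linarith [h.defect_lower i (kb + Lb) s hsτ])
    have hb := abs_botSumOn_le_two_slot h𝕊 h111 ε₀ hq α S (kb + Lb) s (Real.sqrt_nonneg _) hAtop0
      hP (hAtop s hs)
    have hΛ0 : 0 ≤ (1 + ε₀) ^ ((5 : ℝ) * ((kb + Lb : ℤ) : ℝ) / 2) := (Real.rpow_pos_of_pos hq _).le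
    have hsq : Real.sqrt (2 * ∑ j, F j (kb + Lb) s) ^ 2 = 2 * ∑ j, F j (kb + Lb) s :=
      Real.sq_sqrt (by positivity)
    have hsqle : Real.sqrt (2 * ∑ j, F j (kb + Lb) s) ≤ Real.sqrt (2 * Etop) :=
      Real.sqrt_le_sqrt (by linarith [hEtop s hs])
    have hG : Real.sqrt (2 * ∑ j, F j (kb + Lb) s) ^ 2 * Atop +
        Real.sqrt (2 * ∑ j, F j (kb + Lb) s) * Atop ^ 2 ≤
        2 * Etop * Atop + Real.sqrt (2 * Etop) * Atop ^ 2 := by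
      rw [hsq]
      have h1 : 2 * (∑ j, F j (kb + Lb) s) * Atop ≤ 2 * Etop * Atop := by
        have := hEtop s hs; nlinarith
      have h2 : Real.sqrt (2 * ∑ j, F j (kb + Lb) s) * Atop ^ 2 ≤ Real.sqrt (2 * Etop) * Atop ^ 2 :=
        mul_le_mul_of_nonneg_right hsqle (sq_nonneg _)
      linarith
    exact hb.trans (mul_le_mul_of_nonneg_left hG (mul_nonneg hΛ0 hC0))
  -- integrate the two fluxes
  set c1 : ℝ := (1 + ε₀) ^ ((5 : ℝ) * kb / 2) * C * (Pb ^ 2 * Q1 + Pb * Q1 ^ 2) with hc1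
  set c2 : ℝ := (1 + ε₀) ^ ((5 : ℝ) * ((kb + Lb : ℤ) : ℝ) / 2) * C *
    (2 * Etop * Atop + Real.sqrt (2 * Etop) * Atop ^ 2) with hc2
  have hc10 : 0 ≤ c1 := by have := Real.rpow_pos_of_pos hq ((5 : ℝ) * kb / 2); positivity
  have hc20 : 0 ≤ c2 := by
    have := Real.rpow_pos_of_pos hq ((5 : ℝ) * ((kb + Lb : ℤ) : ℝ) / 2); positivity
  have hI1' := intervalIntegral.norm_integral_le_of_norm_le_const (a := (0 : ℝ)) (b := t)
    (f := fun s => botSumOn 𝕊 ε₀ α S kb s) (C := c1) fun s hs => by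
      rw [uIoc_of_le ht.1] at hs
      simpa only [Real.norm_eq_abs] using hin s ⟨hs.1.le, hs.2⟩
  have hI2' := intervalIntegral.norm_integral_le_of_norm_le_const (a := (0 : ℝ)) (b := t)
    (f := fun s => botSumOn 𝕊 ε₀ α S (kb + Lb) s) (C := c2) fun s hs => by
      rw [uIoc_of_le ht.1] at hs
      have := hout s ⟨hs.1.le, hs.2⟩
      simpa only [Real.norm_eq_abs] using this
  have hI1 : |∫ s in (0 : ℝ)..t, botSumOn 𝕊 ε₀ α S kb s| ≤ c1 * t := by
    simpa only [Real.norm_eq_abs, sub_zero, abs_of_nonneg ht.1] using hI1'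
  have hI2 : |∫ s in (0 : ℝ)..t, botSumOn 𝕊 ε₀ α S (kb + Lb) s| ≤ c2 * t := by
    simpa only [Real.norm_eq_abs, sub_zero, abs_of_nonneg ht.1] using hI2'
  have hA1 := le_abs_self (∫ s in (0 : ℝ)..t, botSumOn 𝕊 ε₀ α S kb s)
  have hA2 := neg_abs_le (∫ s in (0 : ℝ)..t, botSumOn 𝕊 ε₀ α S (kb + Lb) s)
  have ht1 : c1 * t ≤ c1 * τ := mul_le_mul_of_nonneg_left ht.2 hc10
  have ht2 : c2 * t ≤ c2 * τ := mul_le_mul_of_nonneg_left ht.2 hc20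
  have hcond' : τ * (c1 + c2) ≤ E₁ / 2 := hcond
  linarith

/-- **Behind improvement step on `𝕊`** (one shell `n`, given amplitude bounds `A ≥ 0` on all shells over
`[0, t]` with `A ≤ Ĝn` on the three neighbours of `n`): the drift `|S_{i,n}(t) − S₀_{i,n}|` is at most
`τ · 2(∑_{𝕊}|α|)(1+ε₀)^{5n/2} Ĝn² +` the defect integral. [cite: Tao2016AveragedNS, §4 Lemma 4.1 (4.8)] -/
theorem pseudoFlowOnShift_behind_improve (h𝕊 : IsNearestNeighbourSet 𝕊)
    (h : PseudoFlowOnShift 𝕊 τ ε₀ α κ₁ κ₂ S₀ F₀ B₀ S F) (hτ : 0 < τ)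
    (hε : 0 ≤ ε₀) {t : ℝ} (ht : t ∈ Icc 0 τ) (i : Fin m) (n : ℤ) {A : ℤ → ℝ} {Ĝn : ℝ}
    (hA0 : ∀ k, 0 ≤ A k) (hAS : ∀ s ∈ Icc 0 t, ∀ (j : Fin m) (k : ℤ), |S j k s| ≤ A k)
    (h3 : ∀ k, n - 1 ≤ k → k ≤ n + 1 → A k ≤ Ĝn) :
    |S i n t - S₀ i n| ≤
      τ * (2 * (∑ i₁, ∑ i₂, ∑ μ ∈ 𝕊, |α i₁ i₂ i μ|) * (1 + ε₀) ^ ((5 : ℝ) * n / 2) * Ĝn * Ĝn) +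
        ∫ u in (0 : ℝ)..t, κ₁ * (1 + ε₀) ^ ((2 : ℝ) * n) * Real.sqrt (F i n u) := by
  have hqpt : ∀ s ∈ Icc 0 t, |quadTermOn 𝕊 ε₀ α S i n s| ≤
      2 * (∑ i₁, ∑ i₂, ∑ μ ∈ 𝕊, |α i₁ i₂ i μ|) * (1 + ε₀) ^ ((5 : ℝ) * n / 2) * Ĝn * Ĝn := by
    intro s hs
    have hb := abs_quadTermOn_sub_quadTermOn_le_of_le h𝕊 ε₀ hε α S (fun _ _ _ => (0 : ℝ)) i n s
      (A := A) (D := A) (Amax := Ĝn) (Dmax := Ĝn) (hAS s hs)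
      (fun j k => by simpa using hA0 k) (fun j k => by simpa using hAS s hs j k) h3 h3
    rwa [quadTermOn_zero_family, sub_zero] at hb
  have hsub : uIcc 0 t ⊆ Icc 0 τ := by
    rw [uIcc_of_le ht.1]; exact Icc_subset_Icc_right ht.2
  have hqint : IntervalIntegrable (fun s => quadTermOn 𝕊 ε₀ α S i n s) volume 0 t :=
    ((pseudoFlowOnShift_continuousOn_quadTermOn h i n).mono hsub).intervalIntegrable
  set Q : ℝ := 2 * (∑ i₁, ∑ i₂, ∑ μ ∈ 𝕊, |α i₁ i₂ i μ|) * (1 + ε₀) ^ ((5 : ℝ) * n / 2) *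
    Ĝn * Ĝn with hQ
  have hQ0 : 0 ≤ Q := (abs_nonneg _).trans (hqpt 0 ⟨le_rfl, ht.1⟩)
  have hI : |∫ s in (0 : ℝ)..t, quadTermOn 𝕊 ε₀ α S i n s| ≤ τ * Q := by
    calc |∫ s in (0 : ℝ)..t, quadTermOn 𝕊 ε₀ α S i n s|
        ≤ ∫ s in (0 : ℝ)..t, |quadTermOn 𝕊 ε₀ α S i n s| :=
          intervalIntegral.abs_integral_le_integral_abs ht.1
      _ ≤ ∫ s in (0 : ℝ)..t, Q :=
          intervalIntegral.integral_mono_on ht.1 hqint.abs (by simp) fun s hs => hqpt s hs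
      _ = t * Q := by simp
      _ ≤ τ * Q := mul_le_mul_of_nonneg_right ht.2 hQ0
  have hmot := pseudoFlowOnShift_motion_integral h hτ i n ht
  have htri : |S i n t - S₀ i n| ≤
      |S i n t - S₀ i n - ∫ s in (0 : ℝ)..t, quadTermOn 𝕊 ε₀ α S i n s| +
        |∫ s in (0 : ℝ)..t, quadTermOn 𝕊 ε₀ α S i n s| := by
    have := abs_add_le (S i n t - S₀ i n - ∫ s in (0 : ℝ)..t, quadTermOn 𝕊 ε₀ α S i n s)
      (∫ s in (0 : ℝ)..t, quadTermOn 𝕊 ε₀ α S i n s)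
    simpa using this
  linarith

/-! ### The joint bootstrap -/

/-- **THE FRONT BLOCK AND THE SHELLS BEHIND IT, JOINTLY, on `𝕊`.** See the module docstring.
[cite: Tao2016AveragedNS, §4 Lemma 4.1 (4.5), (4.8)–(4.9) with (4.3); §6.2 Prop. 6.3 (viii)–(ix)] -/
theorem pseudoFlowOnShift_block_and_behind (h𝕊 : IsNearestNeighbourSet 𝕊) (h𝕊c : IsSlotClosed 𝕊)
    (h111 : ((1 : ℤ), (1 : ℤ), (1 : ℤ)) ∉ 𝕊) (h : PseudoFlowOnShift 𝕊 τ ε₀ α κ₁ κ₂ S₀ F₀ B₀ S F)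
    (hτ : 0 < τ) (hε : 0 < ε₀) (hα : IsCancellingCoeffOn 𝕊 α) (kb : ℤ) (Lb : ℕ) (hLb : 1 ≤ Lb)
    {G Ĝ : ℤ → ℝ} {E₁ Atop L : ℝ} (hG0 : ∀ k, 0 ≤ G k) (hE₁ : 0 < E₁) (hAtop : 0 ≤ Atop) (hL : 0 ≤ L)
    (hstart : ∀ (i : Fin m) (k : ℤ), k ≤ kb → |S₀ i k| ≤ G k)
    (hblock0 : ∑ k ∈ Finset.range Lb, ∑ i, F₀ i (kb + 1 + k) ≤ E₁ / 2)
    (hĜ : ∀ n : ℤ, n ≤ kb → ∀ k : ℤ, n - 1 ≤ k → k ≤ n + 1 → k ≤ kb → 3 * G k ≤ Ĝ n)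
    (hĜb : 2 * Real.sqrt E₁ ≤ Ĝ kb)
    (htop : ∀ t ∈ Icc 0 τ,
      (∀ u ∈ Icc 0 t, ∑ k ∈ Finset.range Lb, ∑ i, F i (kb + 1 + k) u ≤ 2 * E₁) →
        ∀ u ∈ Icc 0 t, ∀ i : Fin m, |S i (kb + 1 + Lb) u| ≤ Atop)
    (hcondBehind : ∀ (i : Fin m) (n : ℤ), n ≤ kb →
      τ * (2 * (∑ i₁, ∑ i₂, ∑ μ ∈ 𝕊, |α i₁ i₂ i μ|) * (1 + ε₀) ^ ((5 : ℝ) * n / 2) *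
        Ĝ n * Ĝ n) ≤ G n / 2)
    (hdefBehind : ∀ (i : Fin m) (n : ℤ), n ≤ kb → ∀ t ∈ Icc 0 τ,
      ∫ u in (0 : ℝ)..t, κ₁ * (1 + ε₀) ^ ((2 : ℝ) * n) * Real.sqrt (F i n u) ≤ G n / 2)
    (hcondBlock : τ * ((1 + ε₀) ^ ((5 : ℝ) * kb / 2) * coeffAbsOn (botShifts 𝕊) α *
        (Ĝ kb ^ 2 * (2 * Real.sqrt E₁) + Ĝ kb * (2 * Real.sqrt E₁) ^ 2) +
      (1 + ε₀) ^ ((5 : ℝ) * ((kb + Lb : ℤ) : ℝ) / 2) * coeffAbsOn (botShifts 𝕊) α *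
        (2 * (2 * E₁) * Atop + Real.sqrt (2 * (2 * E₁)) * Atop ^ 2)) ≤ E₁ / 2)
    (hlipBehind : ∀ (i : Fin m) (n : ℤ), n ≤ kb → ∀ s ∈ Icc 0 τ, ∀ t ∈ Icc 0 τ,
      |S i n t - S i n s| ≤ L * G n * |t - s|)
    (hlipBlock : ∀ s ∈ Icc 0 τ, ∀ t ∈ Icc 0 τ,
      |∑ k ∈ Finset.range Lb, ∑ i, F i (kb + 1 + k) t -
        ∑ k ∈ Finset.range Lb, ∑ i, F i (kb + 1 + k) s| ≤ L * E₁ * |t - s|) :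
    (∀ (i : Fin m) (n : ℤ), n ≤ kb → ∀ t ∈ Icc 0 τ, |S i n t - S₀ i n| ≤ G n) ∧
      ∀ t ∈ Icc 0 τ, ∑ k ∈ Finset.range Lb, ∑ i, F i (kb + 1 + k) t ≤ E₁ := by
  have hq : 0 < 1 + ε₀ := by linarith
  obtain ⟨M, hM0, hM⟩ := pseudoFlowOnShift_uniform_bounds h hq
  have hĜkb0 : 0 ≤ Ĝ kb := le_trans (by positivity) hĜb
  -- the block energy and the family
  set Eb : ℝ → ℝ := fun t => ∑ k ∈ Finset.range Lb, ∑ i, F i (kb + 1 + k) t with hEb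
  set u : Option (Fin m × ℤ) → ℝ → ℝ := fun j t =>
    j.elim (Eb t) (fun jk => if jk.2 ≤ kb then |S jk.1 jk.2 t - S₀ jk.1 jk.2| else 0) with hu
  set p : Option (Fin m × ℤ) → ℝ := fun j => j.elim E₁ (fun jk => G jk.2) with hp
  have key := GappedFrontRobust.bootstrap_family (ι := Option (Fin m × ℤ)) (u := u) (p := p)
    (ψ := fun _ => (1 : ℝ)) (τ := τ) (L := L) ?_ hL continuousOn_const (fun _ _ => one_pos) ?_ ?_ ?_
  · refine ⟨fun i n hn t ht => ?_, fun t ht => ?_⟩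
    · have := key (some (i, n)) t ht
      simp only [hu, hp, Option.elim, hn, if_true, one_mul] at this
      exact this
    · have := key none t ht
      simp only [hu, hp, Option.elim, one_mul] at this
      exact this
  · rintro (_ | ⟨i, n⟩)
    · simp only [hp, Option.elim]; exact hE₁.le
    · simp only [hp, Option.elim]; exact hG0 n
  · -- Lipschitz
    rintro (_ | ⟨i, n⟩) s hs t ht
    · simp only [hu, hp, Option.elim]; exact hlipBlock s hs t ht
    · by_cases hn : n ≤ kb
      · simp only [hu, hp, Option.elim, hn, if_true]
        refine (abs_abs_sub_abs_le_abs_sub _ _).trans ?_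
        have heq : S i n t - S₀ i n - (S i n s - S₀ i n) = S i n t - S i n s := by ring
        rw [heq]; exact hlipBehind i n hn s hs t ht
      · simp only [hu, hp, Option.elim, hn, if_false, sub_self, abs_zero]
        exact mul_nonneg (mul_nonneg hL (hG0 n)) (abs_nonneg _)
  · -- start
    rintro (_ | ⟨i, n⟩)
    · simp only [hu, hp, hEb, Option.elim, one_mul, h.init_F]
      linarith
    · by_cases hn : n ≤ kb
      · simp only [hu, hp, Option.elim, hn, if_true, h.init_S, sub_self, abs_zero, one_mul]; exact hG0 n
      · simp only [hu, hp, Option.elim, hn, if_false, one_mul]; exact hG0 n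
  · -- improvement
    intro t ht hweak j
    have htτ : Icc 0 t ⊆ Icc 0 τ := fun s hs => ⟨hs.1, hs.2.trans ht.2⟩
    have hWbehind : ∀ s ∈ Icc 0 t, ∀ (i : Fin m) (k : ℤ), k ≤ kb → |S i k s| ≤ 3 * G k := by
      intro s hs i k hk
      have hw := hweak (some (i, k)) s hs
      simp only [hu, hp, Option.elim, hk, if_true] at hw
      have hs0 := hstart i k hk
      have htri : |S i k s| ≤ |S i k s - S₀ i k| + |S₀ i k| := by
        have := abs_add_le (S i k s - S₀ i k) (S₀ i k); simpa using this
      linarith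
    have hWblock : ∀ s ∈ Icc 0 t, Eb s ≤ 2 * E₁ := by
      intro s hs
      have hw := hweak none s hs
      simp only [hu, hp, Option.elim] at hw
      linarith
    have hshell : ∀ s ∈ Icc 0 t, ∀ k : ℕ, k < Lb → ∑ i, F i (kb + 1 + k) s ≤ 2 * E₁ := by
      intro s hs k hk
      have h1 : ∑ i, F i (kb + 1 + k) s ≤ Eb s :=
        Finset.single_le_sum (f := fun k : ℕ => ∑ i, F i (kb + 1 + k) s)
          (fun k _ => Finset.sum_nonneg fun i _ => h.nonneg_F i _ s (htτ hs))
          (Finset.mem_range.mpr hk)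
      exact h1.trans (hWblock s hs)
    have hamp1 : ∀ s ∈ Icc 0 t, ∀ i : Fin m, |S i (kb + 1) s| ≤ 2 * Real.sqrt E₁ := by
      intro s hs i
      have hsτ := htτ hs
      have h0 := hshell s hs 0 (by omega)
      simp only [Nat.cast_zero, add_zero] at h0
      have h1 : F i (kb + 1) s ≤ ∑ j, F j (kb + 1) s :=
        Finset.single_le_sum (f := fun j => F j (kb + 1) s) (fun j _ => h.nonneg_F j _ s hsτ)
          (Finset.mem_univ i)
      have h2 := h.defect_lower i (kb + 1) s hsτ
      have h3 : S i (kb + 1) s ^ 2 ≤ (2 * Real.sqrt E₁) ^ 2 := by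
        rw [mul_pow, Real.sq_sqrt hE₁.le]; linarith
      exact abs_le_of_sq_le_sq h3 (by positivity)
    have htopt := htop t ht (fun s hs => hWblock s hs)
    rcases j with _ | ⟨i, n⟩
    · -- the block member
      simp only [hu, hp, Option.elim, one_mul]
      refine pseudoFlowOnShift_block_improve h𝕊 h𝕊c h111 h hτ hε hα kb Lb (Pb := Ĝ kb)
        (Q1 := 2 * Real.sqrt E₁) (Atop := Atop) (Etop := 2 * E₁) hĜkb0 (by positivity) hAtop
        (by linarith) ht hblock0
        (fun s hs i => (hWbehind s hs i kb le_rfl).trans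
          (hĜ kb le_rfl kb (by linarith) (by linarith) le_rfl))
        hamp1 (fun s hs i => ?_) (fun s hs => ?_) hcondBlock
      · have := htopt s hs i
        rwa [show kb + 1 + (Lb : ℤ) = kb + Lb + 1 by ring] at this
      · obtain ⟨L', hL'⟩ : ∃ L' : ℕ, Lb = L' + 1 := ⟨Lb - 1, by omega⟩
        have := hshell s hs L' (by omega)
        rwa [show kb + 1 + (L' : ℤ) = kb + Lb by rw [hL']; push_cast; ring] at this
    · -- a behind member
      by_cases hn : n ≤ kb
      swap
      · simp only [hu, hp, Option.elim, hn, if_false, one_mul]; exact hG0 n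
      simp only [hu, hp, Option.elim, hn, if_true, one_mul]
      set A : ℤ → ℝ := fun k =>
        if k ≤ kb then 3 * G k else if k = kb + 1 then 2 * Real.sqrt E₁ else M with hA
      have hA0 : ∀ k, 0 ≤ A k := fun k => by
        simp only [hA]; split_ifs
        · exact mul_nonneg (by norm_num) (hG0 k)
        · positivity
        · exact hM0
      have hAS : ∀ s ∈ Icc 0 t, ∀ (j : Fin m) (k : ℤ), |S j k s| ≤ A k := by
        intro s hs j k
        simp only [hA]
        split_ifs with hk hk'
        · exact hWbehind s hs j k hk
        · rw [hk']; exact hamp1 s hs j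
        · exact (hM s (htτ hs) j k).1
      have h3 : ∀ k, n - 1 ≤ k → k ≤ n + 1 → A k ≤ Ĝ n := by
        intro k hk1 hk2
        simp only [hA]
        split_ifs with hk hk'
        · exact hĜ n hn k hk1 hk2 hk
        · have : n = kb := by omega
          rw [this]; exact hĜb
        · exfalso; omega
      have hb := pseudoFlowOnShift_behind_improve h𝕊 h hτ hε.le ht i n hA0 hAS h3
      have hc := hcondBehind i n hn
      have hd := hdefBehind i n hn t ht
      linarith

end GappedFrontRobustOn

end Summit.NavierStokesRegularity.NavierStokesRegularity.Theorems

end
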